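import Mathlib
import HarnessLib
import Literature.Geometry.Lorentzian.Stationary
import Literature.Geometry.Lorentzian.IPlusRegular
import Literature.Geometry.Lorentzian.Geodesic
import Literature.Geometry.Lorentzian.Einstein
import Literature.Geometry.Lorentzian.Causality
import Literature.Geometry.Lorentzian.CausalityOpennessProofs
import Literature.Geometry.Lorentzian.MullerZumHagenAnalyticity
import Literature.Geometry.Lorentzian.DocStructureTimeFunction
import Literature.Geometry.Lorentzian.KillingFlowIsometry
import Literature.Geometry.Lorentzian.CommutingFlowLocal
import Literature.Geometry.Lorentzian.KillingFieldOnNaturality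
import Literature.Geometry.Lorentzian.FlowTransportedField
import Literature.Geometry.Lorentzian.LeviCivitaLocality

/-!
# `NonTrappingHawkingRigidity` (crux stmt-FinalStateConjecture-13896), line `Sketch` — stub `stub_invariantKillingSubcollar`

Registered stub S1a of the lead's skeleton `Cruxes/NonTrappingHawkingRigidity/Lines/Sketch.lean` (rev 3.5)
(namespace `…Cruxes.NonTrappingHawkingRigidity.AzimuthalPartialAnalyticity`, `Holds.stub_invariantKillingSubcollar`),
PROVED. The statement below is the REGISTERED signature, letter for letter (Literature vocabulary only).

**Statement (the flow-invariant Killing sub-collar).** Let `𝓑` be an `I⁺`-regular stationary black hole with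
stationary Killing field `T = 𝓑.killing`, `T ≠ 0` on the d.o.c. `⟨⟨M_ext⟩⟩ = 𝓑.doc`, and let `K` be a vector
field which, on an open neighbourhood `U` of the event horizon `𝓔⁺ = 𝓑.horizon`, is `C^∞`, satisfies the
Killing equation and commutes with `T`.  Granted the Chruściel–Costa equivariant time function (the named fact
`chruscielCosta2008_equivariantTimeFunction`, first hypothesis: a function `t`, continuous on `⟨⟨M_ext⟩⟩ ∪ 𝓔⁺`,
with `t(φ_s y) = t(y) + s` along the flow `φ_s` of `T`), there are open sets `U₁ ⊇ 𝓔⁺`, `𝓔⁺ ⊆ V ⊆ U` with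
`V ∩ doc ⊆ U₁`, `U'' ⊇ 𝓔⁺`, and a field `K₁` such that `U₁ ∩ doc` is invariant under the flow of `T`, `K₁` is a
`C^∞` `T`-commuting Killing field on `U₁ ∩ doc`, and `K₁ = K` on `U'' ∩ doc`.  (The remaining hypotheses of the
registered signature — vacuum, `I⁺(M_ext) = M`, simple connectivity, the clauses on `K` along `𝓔⁺`, timelikeness,
the belt and the no-trapping hypotheses — are not used.)

**Proof (canonical transport from the slice `{t = 0}`; Chruściel–Costa 2008, §4.1–4.2).**  Let `θ` be the smooth
global flow of `T` by isometries preserving `doc` and `𝓔⁺` (`StationaryAFBlackHole.exists_stationary_flow`) and put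
`Φ y := θ(-t(y), y)` (the foot-point of `y` on the slice) and
`K₁ y := ((θ_{-t(y)})^* K)(y) = dθ_{t(y)} (K (Φ y))` (Mathlib's `VectorField.mpullback` along the flow map
`θ_{-t(y)}`, `FlowTransportedField.lean`).
* `A := {y ∈ doc | Φ y ∈ U}` is open (`t` is continuous on the open set `doc`) and flow-invariant
  (`Φ(θ_s y) = Φ y` by equivariance and the group law; integral curves of `T` are flow lines,
  `eq_flow_of_isMIntegralCurve`).
* Near `y₀ ∈ A`, `K₁` coincides with ONE transported field `(θ_{-s₀})^* K`, `s₀ := t(y₀)`: indeed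
  `Φ y = θ(s₀ - t(y), θ_{-s₀} y)` and, for `y` near `y₀`, the short orbit piece from `θ_{-s₀} y` to `Φ y` stays in
  `U` (joint continuity of `θ`, continuity of `t`), along which `K` is invariant under the flow because `[T, K] = 0`
  and `T ≠ 0` there (local form of Lee's Thm. 9.42, `mfderiv_flow_apply_eq_of_forall_uIcc_mem`,
  `CommutingFlowLocal.lean`); the chain rule `dθ_{t(y)} ∘ dθ_{s₀ - t(y)} = dθ_{s₀}` concludes.  The transported
  field is `C^∞` (`contMDiffOn_mpullback_flow_neg`), Killing (the `θ_s` are isometries,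
  `IsKillingFieldOn.mpullback_flow_neg`) and commutes with `T` (`mlieBracket_mpullback_flow_neg_eq_zero`) near `y₀`,
  and the three properties only see the germ of the field (`leviCivita_congr_nhds`, `LeviCivitaLocality.lean`;
  `Filter.EventuallyEq.mlieBracket_vectorField_eq`).
* `U'' := U ∩ interior B`, `B := {x | x ∈ doc → θ([[0, t x]], Φ x) ⊆ U}`: for `p ∈ 𝓔⁺` the whole orbit of `p`
  lies on `𝓔⁺ ⊆ U`, so by compactness of `[-|t p| - 1, |t p| + 1]` (`IsCompact.eventually_forall_of_forall_eventually`,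
  the tube lemma) and continuity of `t` at `p` within `doc ∪ 𝓔⁺`, `B` is a neighbourhood of `p`; on `U'' ∩ doc` the
  orbit piece from `Φ x` to `x` lies in `U`, whence `K₁ x = K x` (`mpullback_flow_neg_apply_eq_self_of_forall_uIcc_mem`)
  and `U'' ∩ doc ⊆ A`.  Finally `U₁ := A ∪ U''`, `V := U''`.

References: P. T. Chruściel, J. L. Costa, Astérisque 321 (2008) 195–265, §4.1 (Killing fields defined near `𝓔⁺`
moved by `φ_t[X]_*`) and Thm. 4.5 (the equivariant time function) [ChruscielCosta2008]; J. M. Lee, *Introduction to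
Smooth Manifolds*, 2nd ed., Thm. 9.12 and Thm. 9.42 [LeeSmoothManifolds2013]; B. O'Neill, *Semi-Riemannian
geometry*, Ch. 9, Prop. 9.25 [ONeill1983].
-/

noncomputable section

-- D-0017: single-problem summit, `Summit.<S>.<S>.…` by design
set_option linter.dupNamespace false

namespace Summit.FinalStateConjecture.FinalStateConjecture.Theorems.NonTrappingHawkingRigidity.AzimuthalPartialAnalyticity

open Set Filter Function Bundle Literature.Geometry.Lorentzian
open scoped Manifold ContDiff Topology Nat

section General

variable {E : Type*} [NormedAddCommGroup E] [NormedSpace ℝ E] {H : Type*} [TopologicalSpace H]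
  {I : ModelWithCorners ℝ E H} {M : Type*} [TopologicalSpace M] [ChartedSpace H M] {θ : ℝ × M → M}

/-- **Chain rule for the flow maps**: `dθ_a|_{θ_b p} ∘ dθ_b|_p = dθ_{a+b}|_p` for a `C²` flow `θ` with the
group law `θ_a ∘ θ_b = θ_{a+b}`. Lee 2012, Thm. 9.12. [cite: LeeSmoothManifolds2013, Thm. 9.12] -/
private theorem mfderiv_flow_comp_apply (hθ : ContMDiff (𝓘(ℝ, ℝ).prod I) I 2 θ)
    (hθadd : ∀ t s p, θ (t, θ (s, p)) = θ (t + s, p)) {a b c : ℝ} (habc : a + b = c) (p : M)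
    (v : TangentSpace I p) :
    mfderiv I I (fun q ↦ θ (a, q)) (θ (b, p)) (mfderiv I I (fun q ↦ θ (b, q)) p v) =
      mfderiv I I (fun q ↦ θ (c, q)) p v := by
  have hcomp : (fun q ↦ θ (a, q)) ∘ (fun q ↦ θ (b, q)) = fun q ↦ θ (c, q) :=
    funext fun q ↦ (hθadd a b q).trans (by rw [habc])
  have h := mfderiv_comp p (PseudoRiemannianMetric.mdifferentiableAt_flow hθ a (θ (b, p)))
    (PseudoRiemannianMetric.mdifferentiableAt_flow hθ b p)
  rw [hcomp] at h
  exact (ContinuousLinearMap.ext_iff.1 h v).symm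

end General

/-- **Stub S1a `stub_invariantKillingSubcollar` (registered signature, letter for letter): the flow-invariant
Killing sub-collar.**  Given the Chruściel–Costa equivariant time function `t` (first hypothesis), a `C^∞` Killing
field `K` commuting with the stationary Killing field `T` on an open neighbourhood `U` of `𝓔⁺` is re-defined
flow-invariantly as `K₁ y := dθ_{t(y)} (K (θ(-t(y), y)))` (transport of its slice values by the stationary
isometries `θ_s`); `K₁` is a `C^∞` `T`-commuting Killing field on the open flow-invariant set
`U₁ ∩ doc = {y ∈ doc | θ(-t(y), y) ∈ U}` and agrees with `K` on `U'' ∩ doc` for an open `U'' ⊇ 𝓔⁺` (tube lemma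
along the `T`-orbits in `𝓔⁺ ⊆ U`, local form of Lee's Thm. 9.42); see the module docstring for the proof.
Chruściel–Costa 2008, §4.1 (`φ_t[X]_* Y` for Killing fields defined near `𝓔⁺`) with Thm. 4.5.
[cite: ChruscielCosta2008, §4.1 and Thm. 4.5] -/
theorem stub_invariantKillingSubcollar :
    chruscielCosta2008_equivariantTimeFunction →
    ∀ (𝓑 : StationaryAFBlackHole.{0}) [𝓑.metric.HasLeviCivita],
      𝓑.metric.toPseudoRiemannianMetric.IsRicciFlat → 𝓑.IsIPlusRegular →
      (∀ p : 𝓑.carrier, p ∈ 𝓑.metric.chronologicalFuture 𝓑.timeOrientation 𝓑.Mext) →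
      (∀ p ∈ 𝓑.doc, 𝓑.killing p ≠ 0) → SimplyConnectedSpace 𝓑.doc →
      ∀ (U : Set 𝓑.carrier) (K : Π x : 𝓑.carrier, TangentSpace (𝓡 4) x), IsOpen U → 𝓑.horizon ⊆ U →
      IsConnected 𝓑.horizon →
      ContMDiffOn (𝓡 4) ((𝓡 4).prod 𝓘(ℝ, E4)) ((⊤ : ℕ∞) : WithTop ℕ∞)
        (fun x ↦ (Bundle.TotalSpace.mk' E4 x (K x) : TangentBundle (𝓡 4) 𝓑.carrier)) U →
      (∀ x ∈ U, ∀ v w : TangentSpace (𝓡 4) x,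
        𝓑.metric.val x (𝓑.metric.leviCivita K x v) w + 𝓑.metric.val x v (𝓑.metric.leviCivita K x w) = 0) →
      (∀ x ∈ U, VectorField.mlieBracket (𝓡 4) 𝓑.killing K x = 0) → (∀ p ∈ 𝓑.horizon, K p ≠ 0) →
      (∀ γ : ℝ → 𝓑.carrier, IsMIntegralCurve γ K → γ 0 ∈ 𝓑.horizon → ∀ t, γ t ∈ 𝓑.horizon) →
      (∀ x ∈ U ∩ 𝓑.doc, 𝓑.metric.val x (K x) (K x) < 0) →
      (∃ S₀ : Set 𝓑.carrier, IsCompact S₀ ∧ S₀ ⊆ 𝓑.doc ∧ ∀ y ∈ 𝓑.doc,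
        0 ≤ 𝓑.metric.val y (𝓑.killing y) (𝓑.killing y) → y ∉ U → y ∈ stationaryOrbit 𝓑.killing S₀) →
      (∀ S : Set 𝓑.carrier, IsCompact S → S ⊆ 𝓑.doc → ∀ (γ : ℝ → 𝓑.carrier) (s : Set ℝ),
        IsMaximalGeodesicOn 𝓑.metric.toPseudoRiemannianMetric.leviCivita γ s → s.Nonempty →
        (∀ t ∈ s, 𝓑.metric.val (γ t) (velocity (𝓡 4) γ t) (velocity (𝓡 4) γ t) = 0 ∧
          velocity (𝓡 4) γ t ≠ 0 ∧ 𝓑.metric.val (γ t) (velocity (𝓡 4) γ t) (𝓑.killing (γ t)) = 0) →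
        ∃ t ∈ s, γ t ∉ stationaryOrbit 𝓑.killing S) →
      ∃ (U₁ V U'' : Set 𝓑.carrier) (K₁ : Π x : 𝓑.carrier, TangentSpace (𝓡 4) x),
        IsOpen U₁ ∧ 𝓑.horizon ⊆ U₁ ∧
        (∀ γ : ℝ → 𝓑.carrier, IsMIntegralCurve γ 𝓑.killing → γ 0 ∈ U₁ ∩ 𝓑.doc →
          ∀ t, γ t ∈ U₁ ∩ 𝓑.doc) ∧
        IsOpen V ∧ 𝓑.horizon ⊆ V ∧ V ⊆ U ∧ V ∩ 𝓑.doc ⊆ U₁ ∧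
        (ContMDiffOn (𝓡 4) ((𝓡 4).prod 𝓘(ℝ, E4)) ((⊤ : ℕ∞) : WithTop ℕ∞)
            (fun x ↦ (Bundle.TotalSpace.mk' E4 x (K₁ x) : TangentBundle (𝓡 4) 𝓑.carrier)) (U₁ ∩ 𝓑.doc) ∧
          (∀ x ∈ (U₁ ∩ 𝓑.doc), ∀ v w : TangentSpace (𝓡 4) x,
            𝓑.metric.val x (𝓑.metric.leviCivita K₁ x v) w +
              𝓑.metric.val x v (𝓑.metric.leviCivita K₁ x w) = 0) ∧
          ∀ x ∈ (U₁ ∩ 𝓑.doc), VectorField.mlieBracket (𝓡 4) 𝓑.killing K₁ x = 0) ∧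
        IsOpen U'' ∧ 𝓑.horizon ⊆ U'' ∧ ∀ x ∈ U'' ∩ 𝓑.doc, K₁ x = K x := by
  intro htime 𝓑 _ _hvac hreg _hfut hTnz _hsc U K hU hhorU _hconn hKs hKk hKb _hKnz _hKtan _hKtl _hbelt
    _htrap
  /- (0) the equivariant time function and the stationary flow by isometries -/
  obtain ⟨tf, -, htc, hteq⟩ := htime 𝓑 hreg
  obtain ⟨θ, hθ, hθ0, hθadd, hθT, hiso, -, -, -, -, hdocinv, -, hhorinv⟩ := 𝓑.exists_stationary_flow
  have hθ2 : ContMDiff (𝓘(ℝ, ℝ).prod (𝓡 4)) (𝓡 4) 2 θ := hθ.of_le (ENat.LEInfty.out : (2 : ℕ∞ω) ≤ ∞)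
  have hθc : Continuous θ := hθ.continuous
  have hT : ContMDiff (𝓡 4) (𝓡 4).tangent ∞
      (fun x ↦ (⟨x, 𝓑.killing x⟩ : TangentBundle (𝓡 4) 𝓑.carrier)) :=
    𝓑.isStationaryKilling.isKillingField.contMDiff
  have hT1 : ContMDiff (𝓡 4) (𝓡 4).tangent 1
      (fun x ↦ (⟨x, 𝓑.killing x⟩ : TangentBundle (𝓡 4) 𝓑.carrier)) :=
    hT.of_le (WithTop.coe_le_coe.mpr le_top)
  have hdoc : ∀ p ∈ 𝓑.doc, ∀ s : ℝ, θ (s, p) ∈ 𝓑.doc := fun p hp s ↦ by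
    rw [← hdocinv s]; exact mem_image_of_mem _ hp
  have hhor : ∀ p ∈ 𝓑.horizon, ∀ s : ℝ, θ (s, p) ∈ 𝓑.horizon := fun p hp s ↦ by
    rw [← hhorinv s]; exact mem_image_of_mem _ hp
  have hdoco : IsOpen 𝓑.doc :=
    𝓑.isOpen_doc LorentzianMetric.isOpen_chronologicalFuture_holds_of_boundaryless
      LorentzianMetric.isOpen_chronologicalPast_holds_of_boundaryless
  -- equivariance of the time function along the flow lines starting in `doc ∪ 𝓔⁺`
  have hequiv : ∀ y ∈ 𝓑.doc ∪ 𝓑.horizon, ∀ s : ℝ, tf (θ (s, y)) = tf y + s := by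
    intro y hy s
    have h := hteq (fun s ↦ θ (s, y)) (hθT y) (by simpa only [hθ0] using hy) s
    simpa only [hθ0] using h
  -- every integral curve of `T` is a flow line
  have hflow : ∀ γ : ℝ → 𝓑.carrier, IsMIntegralCurve γ 𝓑.killing → ∀ s, γ s = θ (s, γ 0) :=
    fun γ hγ s ↦ eq_flow_of_isMIntegralCurve hT1 hθT hθ0 hγ s
  -- `K` is smooth at the points of the open set `U`, and a Killing field of `g` on `U`
  have hKat : ∀ x ∈ U, ContMDiffAt (𝓡 4) (𝓡 4).tangent ∞
      (fun x ↦ (⟨x, K x⟩ : TangentBundle (𝓡 4) 𝓑.carrier)) x :=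
    fun x hx ↦ (hKs x hx).contMDiffAt (hU.mem_nhds hx)
  have hKon : 𝓑.metric.toPseudoRiemannianMetric.IsKillingFieldOn K U :=
    PseudoRiemannianMetric.isKillingFieldOn_iff.2 ⟨hKs, hKk⟩
  /- (1) the re-defined field `K₁ y := ((θ_{-t y})^* K) y = dθ_{t y} (K (θ (-t y, y)))` and the sets
  `A := {y ∈ doc | θ(-t y, y) ∈ U}`, `B := {x | x ∈ doc → θ ([[0, t x]], θ(-t x, x)) ⊆ U}` -/
  obtain ⟨K₁, hK₁⟩ : ∃ K₁ : Π x : 𝓑.carrier, TangentSpace (𝓡 4) x,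
      ∀ y, K₁ y = VectorField.mpullback (𝓡 4) (𝓡 4) (fun q ↦ θ (-tf y, q)) K y := ⟨_, fun _ ↦ rfl⟩
  obtain ⟨A, hA⟩ : ∃ A : Set 𝓑.carrier, A = 𝓑.doc ∩ (fun y ↦ θ (-tf y, y)) ⁻¹' U := ⟨_, rfl⟩
  obtain ⟨B, hB⟩ : ∃ B : Set 𝓑.carrier,
      B = {x | x ∈ 𝓑.doc → ∀ s ∈ uIcc 0 (tf x), θ (s, θ (-tf x, x)) ∈ U} := ⟨_, rfl⟩
  have hAo : IsOpen A := by
    have hΦ : ContinuousOn (fun y ↦ θ (-tf y, y)) 𝓑.doc :=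
      hθc.comp_continuousOn ((htc.mono subset_union_left).neg.prodMk continuousOn_id)
    rw [hA]
    exact hΦ.isOpen_inter_preimage hdoco hU
  have hAdoc : A ⊆ 𝓑.doc := by rw [hA]; exact inter_subset_left
  have hAU : ∀ y ∈ A, θ (-tf y, y) ∈ U := by rw [hA]; exact fun y hy ↦ hy.2
  -- `U'' := U ∩ interior B` meets the d.o.c. inside `A`
  have hU''A : ∀ x ∈ U ∩ interior B, x ∈ 𝓑.doc → x ∈ A := by
    rintro x ⟨-, hxB⟩ hxd
    have h : x ∈ B := interior_subset hxB
    rw [hB] at h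
    have h0 := h hxd 0 left_mem_uIcc
    rw [hθ0] at h0
    rw [hA]
    exact ⟨hxd, h0⟩
  -- `B` is a neighbourhood of every point of `𝓔⁺` (tube lemma along the orbit of `p` in `𝓔⁺ ⊆ U`)
  have hhorB : 𝓑.horizon ⊆ interior B := by
    intro p hp
    rw [mem_interior_iff_mem_nhds]
    have h1 : ∀ᶠ x in 𝓝 p, ∀ s ∈ Icc (-(|tf p| + 1)) (|tf p| + 1), θ (s, x) ∈ U := by
      refine isCompact_Icc.eventually_forall_of_forall_eventually fun s _ ↦ ?_
      have hc : Continuous fun z : 𝓑.carrier × ℝ ↦ θ (z.2, z.1) :=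
        hθc.comp (continuous_snd.prodMk continuous_fst)
      exact hc.continuousAt.eventually_mem (hU.mem_nhds (hhorU (hhor p hp s)))
    have h2 : ∀ᶠ x in 𝓝 p, x ∈ 𝓑.doc ∪ 𝓑.horizon → dist (tf x) (tf p) < 1 := by
      have hc : ContinuousWithinAt tf (𝓑.doc ∪ 𝓑.horizon) p := htc p (Or.inr hp)
      exact eventually_nhdsWithin_iff.1 (Metric.tendsto_nhds.1 hc.tendsto 1 one_pos)
    rw [hB]
    filter_upwards [h1, h2] with x h1x h2x
    intro hxd s hs
    rw [hθadd]
    refine h1x _ (abs_le.1 ?_)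
    have hlt := h2x (Or.inl hxd)
    rw [Real.dist_eq] at hlt
    have hs' : |tf x - s| ≤ |tf x - 0| := abs_sub_right_of_mem_uIcc hs
    rw [sub_zero] at hs'
    calc |s + -tf x| = |tf x - s| := by rw [show s + -tf x = -(tf x - s) by ring, abs_neg]
      _ ≤ |tf x| := hs'
      _ = |tf x - tf p + tf p| := by rw [sub_add_cancel]
      _ ≤ |tf x - tf p| + |tf p| := abs_add_le _ _
      _ ≤ |tf p| + 1 := by linarith
  /- (2) near a point `y₀ ∈ A`, `K₁` is ONE transported field `(θ_{-s₀})^* K`, `s₀ := t y₀` -/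
  have hgerm : ∀ y₀ ∈ A,
      K₁ =ᶠ[𝓝 y₀] VectorField.mpullback (𝓡 4) (𝓡 4) (fun q ↦ θ (-tf y₀, q)) K := by
    intro y₀ hy₀
    have hy₀d : y₀ ∈ 𝓑.doc := hAdoc hy₀
    -- joint continuity of `(s, y) ↦ θ (s, θ (-s₀, y))` at `(0, y₀)`, where the value lies in `U`
    have hgc : Continuous fun w : ℝ × 𝓑.carrier ↦ θ (w.1, θ (-tf y₀, w.2)) :=
      hθc.comp (continuous_fst.prodMk (hθc.comp (continuous_const.prodMk continuous_snd)))
    have hmem : (fun w : ℝ × 𝓑.carrier ↦ θ (w.1, θ (-tf y₀, w.2))) ⁻¹' U ∈ 𝓝 ((0 : ℝ), y₀) := by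
      refine hgc.continuousAt.preimage_mem_nhds (hU.mem_nhds ?_)
      show θ (0, θ (-tf y₀, y₀)) ∈ U
      rw [hθ0]
      exact hAU y₀ hy₀
    obtain ⟨u, hu, v, hv, huv⟩ := mem_nhds_prod_iff.1 hmem
    obtain ⟨ε, hε, hεu⟩ := Metric.mem_nhds_iff.1 hu
    have htca : ContinuousAt tf y₀ :=
      (htc.mono subset_union_left).continuousAt (hdoco.mem_nhds hy₀d)
    have h3 : ∀ᶠ y in 𝓝 y₀, dist (tf y) (tf y₀) < ε := Metric.tendsto_nhds.1 htca ε hε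
    filter_upwards [hdoco.mem_nhds hy₀d, hv, h3] with y hyd hyv hyε
    -- the short orbit piece from `θ (-s₀, y)` to `θ (-t y, y)` stays in `U`
    have hseg : ∀ s ∈ uIcc 0 (tf y₀ - tf y), θ (s, θ (-tf y₀, y)) ∈ U := by
      intro s hs
      have hsu : s ∈ u := by
        refine hεu ?_
        rw [Metric.mem_ball, Real.dist_eq]
        rw [Real.dist_eq] at hyε
        calc |s - 0| ≤ |tf y₀ - tf y - 0| := abs_sub_left_of_mem_uIcc hs
          _ = |tf y - tf y₀| := by rw [sub_zero, abs_sub_comm]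
          _ < ε := hyε
      exact huv (mk_mem_prod hsu hyv)
    -- flow-invariance of `K` along it (`[T, K] = 0` on `U`, `T ≠ 0` on the d.o.c.)
    have hinv := mfderiv_flow_apply_eq_of_forall_uIcc_mem hT hU hKat hKb hθ2 hθT hθ0 hθadd
      (hTnz _ (hdoc y hyd (-tf y₀))) hseg
    have hz : θ (tf y₀ - tf y, θ (-tf y₀, y)) = θ (-tf y, y) := by
      rw [hθadd, show tf y₀ - tf y + -tf y₀ = -tf y by ring]
    rw [hK₁, mpullback_flow_neg_apply hθ2 hθ0 hθadd (tf y) K y,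
      mpullback_flow_neg_apply hθ2 hθ0 hθadd (tf y₀) K y, ← hz, ← hinv,
      mfderiv_flow_comp_apply hθ2 hθadd (show tf y + (tf y₀ - tf y) = tf y₀ by ring)]
  /- (3) assembly: `U₁ := A ∪ U''`, `V := U''`, `U'' := U ∩ interior B` -/
  have hU₁A : ∀ y ∈ (A ∪ U ∩ interior B) ∩ 𝓑.doc, y ∈ A := by
    rintro y ⟨hy | hy, hyd⟩
    exacts [hy, hU''A y hy hyd]
  have hhorU'' : 𝓑.horizon ⊆ U ∩ interior B := fun p hp ↦ ⟨hhorU hp, hhorB hp⟩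
  have hU''o : IsOpen (U ∩ interior B) := hU.inter isOpen_interior
  refine ⟨A ∪ U ∩ interior B, U ∩ interior B, U ∩ interior B, K₁, hAo.union hU''o,
    hhorU''.trans subset_union_right, ?_, hU''o, hhorU'', inter_subset_left,
    fun x hx ↦ Or.inr hx.1, ⟨?_, ?_, ?_⟩, hU''o, hhorU'', ?_⟩
  · -- `U₁ ∩ doc = A` is invariant under the flow of `T`
    intro γ hγ hγ0 s
    have hyA : γ 0 ∈ A := hU₁A _ hγ0
    have hyd : γ 0 ∈ 𝓑.doc := hAdoc hyA
    rw [hflow γ hγ s]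
    have hsA : θ (s, γ 0) ∈ A := by
      rw [hA]
      refine ⟨hdoc _ hyd s, ?_⟩
      show θ (-tf (θ (s, γ 0)), θ (s, γ 0)) ∈ U
      rw [hequiv _ (Or.inl hyd) s, hθadd, show -(tf (γ 0) + s) + s = -tf (γ 0) by ring]
      exact hAU _ hyA
    exact ⟨Or.inl hsA, hdoc _ hyd s⟩
  · -- smoothness: `K₁` is, near `y₀`, the `C^∞` field `(θ_{-s₀})^* K`
    intro y₀ hy₀
    have hyA : y₀ ∈ A := hU₁A _ hy₀
    have hpre : y₀ ∈ (fun q ↦ θ (-tf y₀, q)) ⁻¹' U := hAU _ hyA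
    have hsm := contMDiffOn_mpullback_flow_neg hθ hθ0 hθadd (tf y₀) hKs
    have h0 := hsm.contMDiffAt
      ((hU.preimage (hθc.comp (continuous_const.prodMk continuous_id))).mem_nhds hpre)
    have hev : (fun y ↦ (TotalSpace.mk' E4 y (K₁ y) : TangentBundle (𝓡 4) 𝓑.carrier)) =ᶠ[𝓝 y₀]
        (fun y ↦ (TotalSpace.mk' E4 y
          (VectorField.mpullback (𝓡 4) (𝓡 4) (fun q ↦ θ (-tf y₀, q)) K y) :
            TangentBundle (𝓡 4) 𝓑.carrier)) := by
      filter_upwards [hgerm y₀ hyA] with y hy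
      rw [hy]
    exact (h0.congr_of_eventuallyEq hev).contMDiffWithinAt
  · -- the Killing equation: locality of `∇` and `(θ_{-s₀})^* K` is Killing (the `θ_s` are isometries)
    intro y₀ hy₀ v w
    have hyA : y₀ ∈ A := hU₁A _ hy₀
    rw [PseudoRiemannianMetric.leviCivita_congr_nhds 𝓑.metric.toPseudoRiemannianMetric (hgerm y₀ hyA)]
    have hKF := PseudoRiemannianMetric.IsKillingFieldOn.mpullback_flow_neg hθ hiso (tf y₀) hU hKon
    exact (PseudoRiemannianMetric.isKillingFieldOn_iff.1 hKF).2 y₀ (hAU _ hyA) v w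
  · -- the bracket: locality and `[T, (θ_{-s₀})^* K] = (θ_{-s₀})^* [T, K] = 0`
    intro y₀ hy₀
    have hyA : y₀ ∈ A := hU₁A _ hy₀
    rw [(EventuallyEq.rfl (f := 𝓑.killing)).mlieBracket_vectorField_eq (hgerm y₀ hyA)]
    exact mlieBracket_mpullback_flow_neg_eq_zero hT hθ hθT hθ0 hθadd (tf y₀)
      ((hKat _ (hAU _ hyA)).mdifferentiableAt (by simp)) (hKb _ (hAU _ hyA))
  · -- docking: on `U'' ∩ doc` the orbit piece from `θ (-t x, x)` to `x` lies in `U`, so `K₁ x = K x`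
    rintro x ⟨⟨-, hxB⟩, hxd⟩
    have h : x ∈ B := interior_subset hxB
    rw [hB] at h
    rw [hK₁]
    exact mpullback_flow_neg_apply_eq_self_of_forall_uIcc_mem hT hU hKat hKb hθ2 hθT hθ0 hθadd (tf x)
      (hTnz _ (hdoc x hxd _)) (h hxd)

end Summit.FinalStateConjecture.FinalStateConjecture.Theorems.NonTrappingHawkingRigidity.AzimuthalPartialAnalyticity
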